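import Mathlib
import Summits.NavierStokesRegularity.NavierStokesRegularity.Theorems.TypeIQuarterGateScarEnvelopeTypeISatelliteTowerGalleryDefs
import Summits.NavierStokesRegularity.NavierStokesRegularity.Theorems.TypeIQuarterGateScarEnvelopeTypeISatelliteTowerGalleryCompactness

/-!
# The gallery is transitive («tangents of tangents are tangents»); root ω-limits of A–B objects

Part (L1) of the crux idea `Cruxes/ScarEnvelopeTypeI/Ideas/zoom-recurrence.md` (ns-idea-17 g0) in
the tree's convention (`IsGalleryLimit`, module `…SatelliteTowerGalleryDefs`): a gallery limit of a
gallery limit of `U` is a gallery limit of `U` (Furstenberg 2014, Lemma 4 «a mini-set of a micro-set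
is a micro-set», in the parabolic `L³_loc` category) — by the composition law of zooms
`zoom (zoom U x 0 λ) y 0 l = zoom U (x + λ•y) 0 (λ l)`, the exact scaling
`‖zoom f y m − zoom g y m‖_{L³(Q_R(0))} = m^{-2/3} ‖f − g‖_{L³(Q_{mR}(0,y))}` (tree `eLpNorm_zoomAt`),
`Q_{mR}(0,y) ⊆ Q_{‖y‖+mR}(0)` and a diagonal extraction.  Combined with the gallery compactness of
the A–B class (`abTower_of_galleryLimit`, module `…GalleryCompactness`) this gives the «factor 4
paid ONCE» normal form: however deep a descent of gallery limits starting from one A–B object `U`,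
every field met is a.e. an A–B object of the same rate with `𝐈 ≤ 4·𝐈(U)`.  (Root ω-limits: module
`…SatelliteTowerGalleryRootOmega`.)

HONEST FRAMING: analysis / compactness TOOLING about hypothetical Type-I zoom limits for the crux
`TypeIQuarterGate.ScarEnvelopeTypeI` (item 23843); nothing open is proved — 23843,
`∀ M, ¬ OneScarLeaf M`, `∀ M, ¬ InfiniteDescent M`, the route and Navier–Stokes regularity are OPEN.
LEAD-lineage prover ns-sz-p1 g6; `--supports stmt-NavierStokesRegularity-23843 --as helper`.
-/

noncomputable section

-- the summit-side namespace repeats a component by design (single-conjunct summit, D-0017)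
set_option linter.dupNamespace false

open MeasureTheory Set Metric Filter Topology
open scoped ENNReal

namespace Summit.NavierStokesRegularity.NavierStokesRegularity.Cruxes.ScarEnvelopeTypeI.ZoomDictionary

section GalleryTrans

open Literature.Analysis.FluidPDE
variable {U V W : ℝ → (EuclideanSpace ℝ (Fin 3)) → (EuclideanSpace ℝ (Fin 3))}
  {P : ℝ → (EuclideanSpace ℝ (Fin 3)) → ℝ}

/-! ### Zoom algebra -/

/-- Gallery maps compose: zooming `zoom U x 0 λ` about `(0, y)` by `l` is the zoom of `U` about
`(0, x + λ•y)` by `λ l` («a mini-set of a mini-set», Furstenberg 2014 p. 4; ns-idea-17's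
`ZoomRecurrence.zoom_zoom`). -/
theorem zoom_zoom_centre (U : ℝ → (EuclideanSpace ℝ (Fin 3)) → (EuclideanSpace ℝ (Fin 3)))
    (x y : (EuclideanSpace ℝ (Fin 3))) (lam l : ℝ) :
    zoom (zoom U x 0 lam) y 0 l = zoom U (x + lam • y) 0 (lam * l) := by
  funext s z
  simp only [zoom, zero_add, smul_smul, smul_add, add_assoc]
  rw [show l * lam = lam * l from mul_comm _ _,
    show lam ^ 2 * (l ^ 2 * s) = (lam * l) ^ 2 * s by ring]

/-- The root zoom at scale `1` is the identity. -/
theorem zoom_zero_zero_one (U : ℝ → (EuclideanSpace ℝ (Fin 3)) → (EuclideanSpace ℝ (Fin 3))) :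
    zoom U 0 0 1 = U := by
  funext s z
  simp [zoom]

/-- Differences of zooms about `(0, y)` are zooms of the difference (uncurried). -/
theorem uncurry_zoom_sub_zoom (f g : ℝ → (EuclideanSpace ℝ (Fin 3)) → (EuclideanSpace ℝ (Fin 3)))
    (y : (EuclideanSpace ℝ (Fin 3))) (m : ℝ) :
    Function.uncurry (zoom f y 0 m) - Function.uncurry (zoom g y 0 m) =
      Function.uncurry (m • stPull (m ^ 2) m 0 y (f - g)) := by
  funext w
  obtain ⟨s, z⟩ := w
  simp only [Pi.sub_apply, Function.uncurry_apply_pair, zoom, smul_stPull_apply, smul_sub]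

/-- **Exact scaling of `L³` distances under a gallery map**:
`‖zoom f y m − zoom g y m‖_{L³(Q_R(0))} = m · (m⁵)^{-1/3} · ‖f − g‖_{L³(Q_{mR}(0,y))}`. -/
theorem eLpNorm_zoom_sub_zoom (f g : ℝ → (EuclideanSpace ℝ (Fin 3)) → (EuclideanSpace ℝ (Fin 3)))
    (y : (EuclideanSpace ℝ (Fin 3))) {m : ℝ} (hm : 0 < m) (R : ℝ) :
    eLpNorm (Function.uncurry (zoom f y 0 m) - Function.uncurry (zoom g y 0 m)) 3
        (volume.restrict (parabolicCylinder R (0 : ℝ × (EuclideanSpace ℝ (Fin 3))))) =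
      ‖m‖ₑ * (ENNReal.ofReal (m ^ 2 * m ^ 3)⁻¹) ^ (1 / (3 : ℝ≥0∞).toReal) *
        eLpNorm (Function.uncurry f - Function.uncurry g) 3
          (volume.restrict (parabolicCylinder (m * R) (((0 : ℝ), y) : ℝ × (EuclideanSpace ℝ (Fin 3))))) := by
  rw [uncurry_zoom_sub_zoom, eLpNorm_zoomAt hm y m (f - g) R (by norm_num) (by norm_num)]
  rfl

/-- The scaling constant `m · ofReal(m⁻⁵)^{1/3}` of `eLpNorm_zoom_sub_zoom` is finite. -/
theorem zoomConst_lt_top (m : ℝ) :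
    ‖m‖ₑ * (ENNReal.ofReal (m ^ 2 * m ^ 3)⁻¹) ^ (1 / (3 : ℝ≥0∞).toReal) < ⊤ := by
  refine ENNReal.mul_lt_top enorm_lt_top ?_
  exact ENNReal.rpow_lt_top_of_nonneg (by norm_num) ENNReal.ofReal_ne_top

/-- `L³` norms on `Q_r(0, y)` are dominated by those on `Q_{‖y‖+r}(0)`. -/
theorem eLpNorm_cylinder_le_cylinder_zero (h : ℝ × (EuclideanSpace ℝ (Fin 3)) → (EuclideanSpace ℝ (Fin 3)))
    (y : (EuclideanSpace ℝ (Fin 3))) {r : ℝ} (hr : 0 ≤ r) :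
    eLpNorm h 3 (volume.restrict (parabolicCylinder r (((0 : ℝ), y) : ℝ × (EuclideanSpace ℝ (Fin 3))))) ≤
      eLpNorm h 3 (volume.restrict (parabolicCylinder (‖y‖ + r) (0 : ℝ × (EuclideanSpace ℝ (Fin 3))))) :=
  eLpNorm_mono_measure _ (Measure.restrict_mono
    (parabolicCylinder_subset_zero (pow_le_pow_left₀ hr (by linarith [norm_nonneg y]) 2) le_rfl) le_rfl)

/-! ### Measurability and `L³_loc` under gallery maps -/

/-- Zooms of a field that is a.e.-strongly measurable on every `Q_R(0)` are a.e.-strongly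
measurable on every `Q_R(0)`. -/
theorem aestronglyMeasurable_uncurry_zoom
    (hU : ∀ R : ℝ, 0 < R → AEStronglyMeasurable (Function.uncurry U)
      (volume.restrict (parabolicCylinder R (0 : ℝ × (EuclideanSpace ℝ (Fin 3))))))
    (y : (EuclideanSpace ℝ (Fin 3))) {m : ℝ} (hm : 0 < m) {R : ℝ} (hR : 0 < R) :
    AEStronglyMeasurable (Function.uncurry (zoom U y 0 m))
      (volume.restrict (parabolicCylinder R (0 : ℝ × (EuclideanSpace ℝ (Fin 3))))) := by
  have e : Function.uncurry (zoom U y 0 m) =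
      m • (Function.uncurry U ∘ stAffine (m ^ 2) m 0 y) := by
    funext w; rfl
  rw [e, ← preimage_zoomAt hm y R]
  have hg : AEStronglyMeasurable (Function.uncurry U)
      (volume.restrict (parabolicCylinder (m * R) (((0 : ℝ), y) : ℝ × (EuclideanSpace ℝ (Fin 3))))) :=
    (hU (‖y‖ + m * R) (by positivity)).mono_measure (Measure.restrict_mono
      (parabolicCylinder_subset_zero (pow_le_pow_left₀ (by positivity)
        (by linarith [norm_nonneg y]) 2) le_rfl) le_rfl)
  have hqmp : Measure.QuasiMeasurePreserving (stAffine (m ^ 2) m 0 y)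
      (volume.restrict (stAffine (m ^ 2) m 0 y ⁻¹'
        parabolicCylinder (m * R) (((0 : ℝ), y) : ℝ × (EuclideanSpace ℝ (Fin 3)))))
      (volume.restrict (parabolicCylinder (m * R) (((0 : ℝ), y) : ℝ × (EuclideanSpace ℝ (Fin 3))))) := by
    refine ⟨measurable_stAffine _ _ _ _, ?_⟩
    rw [map_stAffine_volume_restrict_preimage (pow_pos hm 2) hm]
    exact Measure.smul_absolutelyContinuous
  exact (hg.comp_quasiMeasurePreserving hqmp).const_smul m

/-- `L³_loc` fields are a.e.-strongly measurable on every `Q_R(0)`. -/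
theorem L3loc.aestronglyMeasurable (hW : L3loc W) {R : ℝ} (hR : 0 < R) :
    AEStronglyMeasurable (Function.uncurry W)
      (volume.restrict (parabolicCylinder R (0 : ℝ × (EuclideanSpace ℝ (Fin 3))))) :=
  (hW R hR).1

/-- The `L³_loc` class is invariant under the gallery maps. -/
theorem L3loc.galleryMap (hW : L3loc W) (y : (EuclideanSpace ℝ (Fin 3))) {m : ℝ} (hm : 0 < m) :
    L3loc (zoom W y 0 m) := by
  intro R hR
  refine ⟨aestronglyMeasurable_uncurry_zoom (fun R hR => (hW R hR).1) y hm hR, ?_⟩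
  have e : Function.uncurry (zoom W y 0 m) =
      Function.uncurry (m • stPull (m ^ 2) m 0 y W) := by
    funext w; rfl
  rw [e, eLpNorm_zoomAt hm y m W R (by norm_num) (by norm_num)]
  refine ENNReal.mul_lt_top (zoomConst_lt_top m) ?_
  exact lt_of_le_of_lt (eLpNorm_cylinder_le_cylinder_zero _ y (by positivity))
    (hW (‖y‖ + m * R) (by positivity)).2

/-- A–B velocity fields are a.e.-strongly measurable on every `Q_R(0)`. -/
theorem ABTower.aestronglyMeasurable_uncurry {M : ℝ}
    {H : ℝ → (EuclideanSpace ℝ (Fin 3)) → (EuclideanSpace ℝ (Fin 3)) →L[ℝ] (EuclideanSpace ℝ (Fin 3))}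
    (h : ABTower M U P H) {R : ℝ} (hR : 0 < R) :
    AEStronglyMeasurable (Function.uncurry U)
      (volume.restrict (parabolicCylinder R (0 : ℝ × (EuclideanSpace ℝ (Fin 3))))) :=
  (h.2.1 R hR).1.distributional.1.aestronglyMeasurable

/-! ### One gallery step applied to a converging family -/

/-- **Gallery maps are continuous along converging zoom families**: if the zooms
`zoom U (x j) 0 (l j)` converge to `V` in `L³(Q_R(0))` for every `R > 0`, then their images under
the gallery map `(y, m)` — which are again zooms of `U`, about `(0, x j + l j • y)` at scale `l j m` —
converge to `zoom V y 0 m`. -/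
theorem ZoomsTendsto.galleryMap {x : ℕ → (EuclideanSpace ℝ (Fin 3))} {l : ℕ → ℝ}
    (hV : ZoomsTendsto U x l V) (y : (EuclideanSpace ℝ (Fin 3))) {m : ℝ} (hm : 0 < m) :
    ZoomsTendsto U (fun j => x j + l j • y) (fun j => l j * m) (zoom V y 0 m) := by
  intro R hR
  have hconv := hV (‖y‖ + m * R) (by positivity)
  have hle : ∀ j, eLpNorm (Function.uncurry (zoom U (x j + l j • y) 0 (l j * m)) -
        Function.uncurry (zoom V y 0 m)) 3
        (volume.restrict (parabolicCylinder R (0 : ℝ × (EuclideanSpace ℝ (Fin 3))))) ≤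
      ‖m‖ₑ * (ENNReal.ofReal (m ^ 2 * m ^ 3)⁻¹) ^ (1 / (3 : ℝ≥0∞).toReal) *
        eLpNorm (Function.uncurry (zoom U (x j) 0 (l j)) - Function.uncurry V) 3
          (volume.restrict (parabolicCylinder (‖y‖ + m * R) (0 : ℝ × (EuclideanSpace ℝ (Fin 3))))) := by
    intro j
    rw [← zoom_zoom_centre, eLpNorm_zoom_sub_zoom _ _ y hm R]
    exact mul_le_mul' le_rfl (eLpNorm_cylinder_le_cylinder_zero _ y (by positivity))
  have h0 : Tendsto (fun j => ‖m‖ₑ * (ENNReal.ofReal (m ^ 2 * m ^ 3)⁻¹) ^ (1 / (3 : ℝ≥0∞).toReal) *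
        eLpNorm (Function.uncurry (zoom U (x j) 0 (l j)) - Function.uncurry V) 3
          (volume.restrict (parabolicCylinder (‖y‖ + m * R) (0 : ℝ × (EuclideanSpace ℝ (Fin 3))))))
      atTop (𝓝 0) := by
    have h := ENNReal.Tendsto.const_mul hconv (Or.inr (zoomConst_lt_top m).ne)
    rwa [mul_zero] at h
  exact tendsto_of_tendsto_of_tendsto_of_le_of_le tendsto_const_nhds h0 (fun _ => zero_le) hle

/-! ### Transitivity of the gallery -/

/-- **The gallery is transitive** («a mini-set of a micro-set is a micro-set», Furstenberg 2014
Lemma 4, parabolic `L³_loc` version; ns-idea-17's (L1) with the `L³_loc` clause): if `V` is a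
gallery limit of `U` and `W` a gallery limit of `V`, then `W` is a gallery limit of `U` — for `U`
a.e.-strongly measurable on every `Q_R(0)` (e.g. any A–B velocity field). -/
theorem IsGalleryLimit.trans
    (hU : ∀ R : ℝ, 0 < R → AEStronglyMeasurable (Function.uncurry U)
      (volume.restrict (parabolicCylinder R (0 : ℝ × (EuclideanSpace ℝ (Fin 3))))))
    (hUV : IsGalleryLimit U V) (hVW : IsGalleryLimit V W) : IsGalleryLimit U W := by
  obtain ⟨hV3, x, l, hl, hxV⟩ := hUV
  obtain ⟨hW3, y, m, hm, hyW⟩ := hVW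
  refine ⟨hW3, ?_⟩
  -- the two error terms at level `n` (cylinder `Q_{n+1}(0)`)
  set Q : ℕ → Set (ℝ × (EuclideanSpace ℝ (Fin 3))) :=
    fun n => parabolicCylinder ((n : ℝ) + 1) (0 : ℝ × (EuclideanSpace ℝ (Fin 3))) with hQ
  have hnpos : ∀ n : ℕ, (0 : ℝ) < (n : ℝ) + 1 := fun n => by positivity
  have hθ : ∀ n : ℕ, (0 : ℝ≥0∞) < ((n : ℝ≥0∞) + 1)⁻¹ := fun n =>
    ENNReal.inv_pos.2 (by simp)
  -- first choice: `i n` with `‖zoom V (y i) (m i) − W‖_{L³(Q_{n+1})} ≤ (n+1)⁻¹`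
  have hex1 : ∀ n : ℕ, ∃ i : ℕ, eLpNorm (Function.uncurry (zoom V (y i) 0 (m i)) - Function.uncurry W) 3
      (volume.restrict (Q n)) ≤ ((n : ℝ≥0∞) + 1)⁻¹ := fun n =>
    ((ENNReal.tendsto_nhds_zero.1 (hyW _ (hnpos n))) _ (hθ n)).exists
  choose i hi using hex1
  -- second choice: `j n` with `‖zoom U (x j + l j • y (i n)) (l j m (i n)) − zoom V (y (i n)) (m (i n))‖ ≤ (n+1)⁻¹`
  have hex2 : ∀ n : ℕ, ∃ j : ℕ, eLpNorm (Function.uncurry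
      (zoom U (x j + l j • y (i n)) 0 (l j * m (i n))) -
        Function.uncurry (zoom V (y (i n)) 0 (m (i n)))) 3 (volume.restrict (Q n)) ≤
      ((n : ℝ≥0∞) + 1)⁻¹ := fun n =>
    ((ENNReal.tendsto_nhds_zero.1 ((hxV.galleryMap (y (i n)) (hm (i n))) _ (hnpos n))) _ (hθ n)).exists
  choose j hj using hex2
  refine ⟨fun n => x (j n) + l (j n) • y (i n), fun n => l (j n) * m (i n),
    fun n => mul_pos (hl _) (hm _), fun R hR => ?_⟩
  -- the diagonal sequence converges on every `Q_R(0)`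
  have hbound : ∀ n : ℕ, R ≤ (n : ℝ) + 1 →
      eLpNorm (Function.uncurry (zoom U (x (j n) + l (j n) • y (i n)) 0 (l (j n) * m (i n))) -
          Function.uncurry W) 3
          (volume.restrict (parabolicCylinder R (0 : ℝ × (EuclideanSpace ℝ (Fin 3))))) ≤
        ((n : ℝ≥0∞) + 1)⁻¹ + ((n : ℝ≥0∞) + 1)⁻¹ := by
    intro n hn
    have hsub : parabolicCylinder R (0 : ℝ × (EuclideanSpace ℝ (Fin 3))) ⊆ Q n :=
      parabolicCylinder_mono hR.le hn _
    refine le_trans (eLpNorm_mono_measure _ (Measure.restrict_mono hsub le_rfl)) ?_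
    have hA : AEStronglyMeasurable (Function.uncurry
        (zoom U (x (j n) + l (j n) • y (i n)) 0 (l (j n) * m (i n)))) (volume.restrict (Q n)) :=
      aestronglyMeasurable_uncurry_zoom hU _ (mul_pos (hl _) (hm _)) (hnpos n)
    have hB : AEStronglyMeasurable (Function.uncurry (zoom V (y (i n)) 0 (m (i n))))
        (volume.restrict (Q n)) :=
      aestronglyMeasurable_uncurry_zoom (fun R hR => (hV3 R hR).1) _ (hm _) (hnpos n)
    have hC : AEStronglyMeasurable (Function.uncurry W) (volume.restrict (Q n)) := (hW3 _ (hnpos n)).1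
    have e : Function.uncurry (zoom U (x (j n) + l (j n) • y (i n)) 0 (l (j n) * m (i n))) -
        Function.uncurry W =
        (Function.uncurry (zoom U (x (j n) + l (j n) • y (i n)) 0 (l (j n) * m (i n))) -
          Function.uncurry (zoom V (y (i n)) 0 (m (i n)))) +
        (Function.uncurry (zoom V (y (i n)) 0 (m (i n))) - Function.uncurry W) := by abel
    rw [e]
    exact (eLpNorm_add_le (hA.sub hB) (hB.sub hC) (by norm_num)).trans (add_le_add (hj n) (hi n))
  have hθ0 : Tendsto (fun n : ℕ => ((n : ℝ≥0∞) + 1)⁻¹ + ((n : ℝ≥0∞) + 1)⁻¹) atTop (𝓝 0) := by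
    have h1 : Tendsto (fun n : ℕ => ((n : ℝ≥0∞) + 1)⁻¹) atTop (𝓝 0) := by
      have h := ENNReal.tendsto_inv_nat_nhds_zero.comp (tendsto_add_atTop_nat 1)
      refine h.congr fun n => ?_
      simp only [Function.comp_apply, Nat.cast_add, Nat.cast_one]
    simpa using h1.add h1
  refine ENNReal.tendsto_nhds_zero.2 fun ε hε => ?_
  obtain ⟨N, hN⟩ := exists_nat_ge R
  filter_upwards [(ENNReal.tendsto_nhds_zero.1 hθ0) ε hε, eventually_ge_atTop N] with n hn hnN
  refine (hbound n ?_).trans hn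
  calc R ≤ (N : ℝ) := hN
    _ ≤ (n : ℝ) := by exact_mod_cast hnN
    _ ≤ (n : ℝ) + 1 := by linarith

/-- Every `L³_loc` field is a gallery limit of itself (centre `0`, scale `1`). -/
theorem isGalleryLimit_self (hU : L3loc U) : IsGalleryLimit U U := by
  refine ⟨hU, fun _ => 0, fun _ => 1, fun _ => one_pos, fun R hR => ?_⟩
  simp only [zoom_zero_zero_one, sub_self, eLpNorm_zero]
  exact tendsto_const_nhds

/-- Gallery limits are stable under the gallery maps. -/
theorem IsGalleryLimit.galleryMap (hUV : IsGalleryLimit U V) (y : (EuclideanSpace ℝ (Fin 3))) {m : ℝ}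
    (hm : 0 < m) : IsGalleryLimit U (zoom V y 0 m) := by
  obtain ⟨hV3, x, l, hl, hxV⟩ := hUV
  exact ⟨hV3.galleryMap y hm, fun j => x j + l j • y, fun j => l j * m, fun j => mul_pos (hl j) hm,
    hxV.galleryMap y hm⟩


/-! ### Gallery limits of A–B objects (one factor 4, however deep) -/

/-- **Gallery limits of A–B objects are A–B objects** (`𝐈 ≤ 4·𝐈(U)`), a.e. on every `Q_R(0)`. -/
theorem abTower_of_isGalleryLimit {M : ℝ}
    {H : ℝ → (EuclideanSpace ℝ (Fin 3)) → (EuclideanSpace ℝ (Fin 3)) →L[ℝ] (EuclideanSpace ℝ (Fin 3))}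
    (h : ABTower M U P H) (hW : IsGalleryLimit U W) :
    ∃ (U' : ℝ → (EuclideanSpace ℝ (Fin 3)) → (EuclideanSpace ℝ (Fin 3))) (P' : ℝ → (EuclideanSpace ℝ (Fin 3)) → ℝ)
      (H' : ℝ → (EuclideanSpace ℝ (Fin 3)) → (EuclideanSpace ℝ (Fin 3)) →L[ℝ] (EuclideanSpace ℝ (Fin 3))),
      ABTower M U' P' H' ∧
      typeIBound (Iio (0 : ℝ) ×ˢ univ) U' P' H' ≤ 4 * typeIBound (Iio (0 : ℝ) ×ˢ univ) U P H ∧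
      ∀ R : ℝ, 0 < R → ∀ᵐ z ∂(volume.restrict (parabolicCylinder R (0 : ℝ × (EuclideanSpace ℝ (Fin 3))))),
        W z.1 z.2 = U' z.1 z.2 := by
  obtain ⟨hW3, x, l, hl, hconv⟩ := hW
  obtain ⟨U', P', H', hAB, h4, hae, -⟩ := abTower_of_galleryLimit h x hl hW3 hconv
  exact ⟨U', P', H', hAB, h4, hae⟩

/-- **The gallery of an A–B object is sequentially precompact inside the class**: every sequence
of centres and positive scales has a subsequence along which the zooms converge to a gallery limit
that is itself an A–B object of the same rate with `𝐈 ≤ 4·𝐈(U)`. -/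
theorem ABTower.exists_isGalleryLimit {M : ℝ}
    {H : ℝ → (EuclideanSpace ℝ (Fin 3)) → (EuclideanSpace ℝ (Fin 3)) →L[ℝ] (EuclideanSpace ℝ (Fin 3))}
    (h : ABTower M U P H) (x : ℕ → (EuclideanSpace ℝ (Fin 3))) {l : ℕ → ℝ} (hl : ∀ k, 0 < l k) :
    ∃ (U' : ℝ → (EuclideanSpace ℝ (Fin 3)) → (EuclideanSpace ℝ (Fin 3))) (P' : ℝ → (EuclideanSpace ℝ (Fin 3)) → ℝ)
      (H' : ℝ → (EuclideanSpace ℝ (Fin 3)) → (EuclideanSpace ℝ (Fin 3)) →L[ℝ] (EuclideanSpace ℝ (Fin 3)))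
      (σ : ℕ → ℕ), StrictMono σ ∧ ABTower M U' P' H' ∧
      typeIBound (Iio (0 : ℝ) ×ˢ univ) U' P' H' ≤ 4 * typeIBound (Iio (0 : ℝ) ×ˢ univ) U P H ∧
      L3loc U' ∧ ZoomsTendsto U (x ∘ σ) (l ∘ σ) U' := by
  obtain ⟨U', P', H', σ, hσ, hAB, h4, hmem, hconv, -⟩ := abTower_galleryCompact h x hl
  exact ⟨U', P', H', σ, hσ, hAB, h4, hmem, hconv⟩


/-- **The factor 4 is paid ONCE**: a gallery limit of a gallery limit of an A–B object `U` is a.e.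
an A–B object of the same rate with `𝐈 ≤ 4·𝐈(U)` (not `16·𝐈(U)`), by transitivity. -/
theorem abTower_of_isGalleryLimit₂ {M : ℝ}
    {H : ℝ → (EuclideanSpace ℝ (Fin 3)) → (EuclideanSpace ℝ (Fin 3)) →L[ℝ] (EuclideanSpace ℝ (Fin 3))}
    (h : ABTower M U P H) (hV : IsGalleryLimit U V) (hW : IsGalleryLimit V W) :
    ∃ (U' : ℝ → (EuclideanSpace ℝ (Fin 3)) → (EuclideanSpace ℝ (Fin 3))) (P' : ℝ → (EuclideanSpace ℝ (Fin 3)) → ℝ)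
      (H' : ℝ → (EuclideanSpace ℝ (Fin 3)) → (EuclideanSpace ℝ (Fin 3)) →L[ℝ] (EuclideanSpace ℝ (Fin 3))),
      ABTower M U' P' H' ∧
      typeIBound (Iio (0 : ℝ) ×ˢ univ) U' P' H' ≤ 4 * typeIBound (Iio (0 : ℝ) ×ˢ univ) U P H ∧
      ∀ R : ℝ, 0 < R → ∀ᵐ z ∂(volume.restrict (parabolicCylinder R (0 : ℝ × (EuclideanSpace ℝ (Fin 3))))),
        W z.1 z.2 = U' z.1 z.2 :=
  abTower_of_isGalleryLimit h (hV.trans (fun _ hR => h.aestronglyMeasurable_uncurry hR) hW)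


end GalleryTrans

end Summit.NavierStokesRegularity.NavierStokesRegularity.Cruxes.ScarEnvelopeTypeI.ZoomDictionary
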